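import Literature.Geometry.Riemannian.SegmentInequality
import Literature.Geometry.Riemannian.LipschitzSmoothing
import Literature.Geometry.Riemannian.BakryEmeryHeatFlow
import HarnessLib

/-!
# The (1,1)-Poincaré inequality on balls from the segment inequality (`Ric ≥ -(d-1)`)

Cheeger–Colding 1996, Remark 2.82: "Theorem 2.11 [the segment inequality] leads directly to a
lower bound on the smallest nonzero eigenvalue of the Laplacian and to Poincaré type
inequalities" (for smooth manifolds the inequality is P. Buser's, Ann. Sci. ÉNS 15 (1982),
Lemma 5.1; in the Cheeger–Colding theory it is the form in which it passes to limit spaces).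
We PROVE, on a connected second countable Riemannian `d`-manifold with complete Levi-Civita
connection and `Ric ≥ -(d-1) g`:

* `ofReal_abs_sub_le_mul_lintegral_of_mvfderiv_le` — for `u ∈ C¹` with an upper gradient
  `F : M → [0, ∞]` (`|du_x(w)| ≤ F(x) |w|_g`), along every radial geodesic
  `|u(exp_x v) − u(x)| ≤ |v|_g ∫₀¹ F(exp_x(tv)) dt` (fundamental theorem of calculus), whence
  `|u(x) − u(y)| ≤ ℱ_F(x, y)` (`segmentIntegral`);
* `edist_expMap_smul_lt_of_isMinimizingUpTo` — minimal geodesics between points of `B_R(p)` lie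
  in `B_{2R}(p)`;
* `setLIntegral_prod_abs_sub_le` — for lower semicontinuous upper gradients `F`:
  `∫_{B_R(p) × B_R(p)} |u(x) − u(y)| d(Vol × Vol) ≤ 2R (2cosh R)^{d-1} · 2Vol(B_R(p)) · ∫_{B_{2R}(p)} F`
  (the segment inequality `setLIntegral_prod_segmentIntegral_le` with `D = 2R`);
* `setLIntegral_prod_abs_sub_le_gradient` — the same for smooth `u` with `F = |∇u|_g`
  (`gradSq`, Cauchy–Schwarz `abs_mvfderiv_le_sqrt_gradSq_mul_sqrt`).

Dividing by `Vol(B_R(p))` gives the mean-oscillation form `∫_B |u − u_B| ≤ C(d, R) ∫_{2B} |∇u|`.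
No definitions, no named facts (D-0026). Groundwork for `CheegerColding1997_sphereStability`.

## References

* J. Cheeger, T. H. Colding, *Lower bounds on Ricci curvature and the almost rigidity of warped
  products*, Ann. of Math. 144 (1996) 189–237, §2, Thm. 2.11 and Remark 2.82.
  [CheegerColding1996]
* P. Buser, *A note on the isoperimetric constant*, Ann. Sci. École Norm. Sup. (4) 15 (1982)
  213–230, Lemma 5.1. [Buser1982]
-/

noncomputable section

open Bundle Set Function Filter MeasureTheory Manifold
open scoped Manifold ContDiff Topology ENNReal NNReal

namespace Literature.Geometry.Riemannian

open Lorentzian Lorentzian.PseudoRiemannianMetric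

/-! ### Differences along minimal geodesics and the (1,1)-Poincaré inequality -/

section Poincare

variable {d : ℕ} {M : Type*} [TopologicalSpace M] [ChartedSpace (EuclideanSpace ℝ (Fin d)) M]
  [IsManifold 𝓘(ℝ, EuclideanSpace ℝ (Fin d)) ∞ M] [T2Space M]
  (g : PseudoRiemannianMetric 𝓘(ℝ, EuclideanSpace ℝ (Fin d)) ∞ (EuclideanSpace ℝ (Fin d))
    (TangentSpace 𝓘(ℝ, EuclideanSpace ℝ (Fin d)) : M → Type _)) [g.HasLeviCivita]
  [CovariantDerivative.ContMDiffCovariantDerivative g.leviCivita 1]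
  [CovariantDerivative.ContMDiffCovariantDerivative g.leviCivita ∞]

/-- **Differences along radial geodesics are controlled by upper gradients**: if `u : M → ℝ` is
`C¹` and `F : M → [0, ∞]` bounds its differential, `|du_x(w)| ≤ F(x) |w|_g`, then along the
geodesic `γ_v(t) = exp_x(tv)` of a complete connection
`|u(exp_x v) − u(x)| ≤ |v|_g ∫_{(0,1)} F(γ_v(t)) dt` (fundamental theorem of calculus for `u ∘ γ_v`,
whose derivative is `du(γ_v')`, `|γ_v'|_g ≡ |v|_g`). [folklore] -/
theorem ofReal_abs_sub_le_mul_lintegral_of_mvfderiv_le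
    (hc : IsGeodesicallyComplete g.leviCivita) {u : M → ℝ}
    (hu : ContMDiff 𝓘(ℝ, (EuclideanSpace ℝ (Fin d))) 𝓘(ℝ, ℝ) 1 u) {F : M → ℝ≥0∞}
    (hF : ∀ (x : M) (w : TangentSpace 𝓘(ℝ, (EuclideanSpace ℝ (Fin d))) x),
      ENNReal.ofReal |mvfderiv 𝓘(ℝ, (EuclideanSpace ℝ (Fin d))) u x w| ≤
        F x * ENNReal.ofReal (Real.sqrt (g.val x w w)))
    (x : M) (v : TangentSpace 𝓘(ℝ, (EuclideanSpace ℝ (Fin d))) x) :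
    ENNReal.ofReal |u (expMap g.leviCivita x v) - u x| ≤
      ENNReal.ofReal (Real.sqrt (g.val x v v)) *
        ∫⁻ t in Ioo (0 : ℝ) 1, F (expMap g.leviCivita x (t • v)) := by
  haveI : Fact ((1 : ℕ∞ω) ≤ (∞ : ℕ∞ω)) := ⟨by exact_mod_cast le_top⟩
  -- the geodesic and its speed
  set γ : ℝ → M := fun t ↦ expMap g.leviCivita x (t • v) with hγ_def
  obtain ⟨-, hgeo', hγ0', hγv'⟩ := maximalGeodesic_of_isGeodesicallyComplete hc x v
  have hγfun : γ = maximalGeodesic g.leviCivita x v := funext fun t ↦ expMap_smul hc x v t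
  have hgeo : IsGeodesic g.leviCivita γ := by rw [hγfun]; exact hgeo'
  have hγs : ContMDiff 𝓘(ℝ, ℝ) 𝓘(ℝ, (EuclideanSpace ℝ (Fin d))) ∞ γ := by
    rw [hγfun]
    exact (contMDiff_maximalGeodesic_family hc x).comp
      (contMDiff_id.prodMk (contMDiff_const (c := (show EuclideanSpace ℝ (Fin d) from v))))
  have hγ0 : γ 0 = x := by
    show expMap g.leviCivita x ((0 : ℝ) • v) = x
    rw [zero_smul]; exact expMap_zero (cov := g.leviCivita) x
  have hγ1 : γ 1 = expMap g.leviCivita x v := by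
    show expMap g.leviCivita x ((1 : ℝ) • v) = _; rw [one_smul]
  have hspeed : ∀ t, g.val (γ t) (velocity 𝓘(ℝ, (EuclideanSpace ℝ (Fin d))) γ t)
      (velocity 𝓘(ℝ, (EuclideanSpace ℝ (Fin d))) γ t) = g.val x v v := by
    intro t
    have h := g.val_velocity_eq_of_isGeodesicOn_holds isOpen_univ ordConnected_univ hgeo
      (mem_univ t) (mem_univ 0)
    have hv0 : (velocity 𝓘(ℝ, (EuclideanSpace ℝ (Fin d))) γ 0 : EuclideanSpace ℝ (Fin d)) =
        (v : EuclideanSpace ℝ (Fin d)) := velocity_expMap_smul_zero x v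
    rw [h, hv0, hγ0]
  -- `u ∘ γ` is `C¹` with derivative `du(γ')`
  have hcomp : ContMDiff 𝓘(ℝ, ℝ) 𝓘(ℝ, ℝ) 1 (fun t ↦ u (γ t)) :=
    hu.comp (hγs.of_le (by exact_mod_cast le_top))
  have hcd : ContDiff ℝ 1 (fun t ↦ u (γ t)) := contMDiff_iff_contDiff.1 hcomp
  have hderiv : ∀ t, HasDerivAt (fun t' ↦ u (γ t'))
      (mvfderiv 𝓘(ℝ, (EuclideanSpace ℝ (Fin d))) u (γ t)
        (velocity 𝓘(ℝ, (EuclideanSpace ℝ (Fin d))) γ t)) t := fun t ↦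
    hasDerivAt_comp_curve_mvfderiv ((hu (γ t)).mdifferentiableAt one_ne_zero)
      ((hγs t).mdifferentiableAt (by simp))
  have hderiv_eq : deriv (fun t' ↦ u (γ t')) = fun t ↦
      mvfderiv 𝓘(ℝ, (EuclideanSpace ℝ (Fin d))) u (γ t)
        (velocity 𝓘(ℝ, (EuclideanSpace ℝ (Fin d))) γ t) := funext fun t ↦ (hderiv t).deriv
  have hdc : Continuous (deriv fun t' ↦ u (γ t')) := hcd.continuous_deriv le_rfl
  -- the fundamental theorem of calculus
  have hftc : u (γ 1) - u (γ 0) = ∫ t in (0 : ℝ)..1, deriv (fun t' ↦ u (γ t')) t := by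
    rw [intervalIntegral.integral_deriv_eq_sub (fun t _ ↦ (hderiv t).differentiableAt)
      (hdc.intervalIntegrable _ _)]
  have habs : |u (γ 1) - u (γ 0)| ≤ ∫ t in (0 : ℝ)..1, |deriv (fun t' ↦ u (γ t')) t| := by
    rw [hftc]
    exact intervalIntegral.abs_integral_le_integral_abs zero_le_one
  -- comparison with the `lintegral`
  have hint : IntegrableOn (fun t ↦ |deriv (fun t' ↦ u (γ t')) t|) (Ioc (0 : ℝ) 1) :=
    (hdc.abs.integrableOn_Icc (a := 0) (b := 1)).mono_set Ioc_subset_Icc_self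
  have hrw : u (expMap g.leviCivita x v) - u x = u (γ 1) - u (γ 0) := by rw [hγ1, hγ0]
  rw [hrw]
  calc ENNReal.ofReal |u (γ 1) - u (γ 0)|
      ≤ ENNReal.ofReal (∫ t in (0 : ℝ)..1, |deriv (fun t' ↦ u (γ t')) t|) :=
        ENNReal.ofReal_le_ofReal habs
    _ = ∫⁻ t in Ioc (0 : ℝ) 1, ENNReal.ofReal |deriv (fun t' ↦ u (γ t')) t| := by
        rw [intervalIntegral.integral_of_le zero_le_one,
          ofReal_integral_eq_lintegral_ofReal hint (ae_of_all _ fun t ↦ abs_nonneg _)]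
    _ = ∫⁻ t in Ioo (0 : ℝ) 1, ENNReal.ofReal |deriv (fun t' ↦ u (γ t')) t| := by
        rw [Measure.restrict_congr_set Ioo_ae_eq_Ioc]
    _ ≤ ∫⁻ t in Ioo (0 : ℝ) 1, F (γ t) * ENNReal.ofReal (Real.sqrt (g.val x v v)) := by
        refine lintegral_mono fun t ↦ ?_
        rw [hderiv_eq]
        have h := hF (γ t) (velocity 𝓘(ℝ, (EuclideanSpace ℝ (Fin d))) γ t)
        rwa [hspeed t] at h
    _ = ENNReal.ofReal (Real.sqrt (g.val x v v)) * ∫⁻ t in Ioo (0 : ℝ) 1, F (γ t) := by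
        rw [lintegral_mul_const' _ _ ENNReal.ofReal_ne_top, mul_comm]


omit [CovariantDerivative.ContMDiffCovariantDerivative g.leviCivita ∞] in
/-- **Minimal geodesics between points of a ball `B_R(p)` stay in `B_{2R}(p)`**: if
`d(p, x), d(p, y) < R` and `γ_v|[0,1]` is a minimal geodesic from `x` to `y`, then
`d(p, γ_v(t)) < 2R` for `t ∈ [0, 1]` (`d(x, γ_v t) ≤ t ℓ`, `d(γ_v t, y) ≤ (1 - t) ℓ`,
`ℓ = d(x, y) < 2R`). [folklore] -/
theorem edist_expMap_smul_lt_of_isMinimizingUpTo (hg : g.IsRiemannian)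
    (hc : IsGeodesicallyComplete g.leviCivita) {p x y : M} {R : ℝ}
    (hx : g.edist hg p x < ENNReal.ofReal R) (hy : g.edist hg p y < ENNReal.ofReal R)
    {v : TangentSpace 𝓘(ℝ, (EuclideanSpace ℝ (Fin d))) x} (hv : IsMinimizingUpTo g hg x v 1)
    (hvy : expMap g.leviCivita x v = y) {t : ℝ} (ht : t ∈ Icc (0 : ℝ) 1) :
    g.edist hg p (expMap g.leviCivita x (t • v)) < ENNReal.ofReal (2 * R) := by
  haveI : Fact ((1 : ℕ∞ω) ≤ (∞ : ℕ∞ω)) := ⟨by exact_mod_cast le_top⟩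
  have hR : 0 < R := by
    by_contra hR
    rw [ENNReal.ofReal_of_nonpos (not_lt.1 hR)] at hx
    exact ENNReal.not_lt_zero hx
  set ℓ : ℝ := Real.sqrt (g.val x v v) with hℓ
  have hℓ0 : 0 ≤ ℓ := Real.sqrt_nonneg _
  have hmin : ENNReal.ofReal ℓ = g.edist hg x y := by
    rw [(isMinimizingUpTo_one_iff hg hc x v).1 hv, hvy]
  obtain ⟨-, -, hγ0, -⟩ := maximalGeodesic_of_isGeodesicallyComplete hc x v
  have hγ1 : maximalGeodesic g.leviCivita x v 1 = y := by
    rw [← expMap_eq_maximalGeodesic hc x v]; exact hvy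
  -- `d(x, γ t) ≤ t ℓ` and `d(γ t, y) ≤ (1 - t) ℓ`
  have h1 : g.edist hg x (expMap g.leviCivita x (t • v)) ≤ ENNReal.ofReal (t * ℓ) := by
    have h := edist_maximalGeodesic_le_length hg hc x v (a := 0) (b := t) ht.1
    rw [length_maximalGeodesic hg hc x v 0 t, sub_zero, hγ0, ← expMap_smul hc x v t] at h
    exact h
  have h2 : g.edist hg (expMap g.leviCivita x (t • v)) y ≤ ENNReal.ofReal ((1 - t) * ℓ) := by
    have h := edist_maximalGeodesic_le_length hg hc x v (a := t) (b := 1) ht.2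
    rw [length_maximalGeodesic hg hc x v t 1, hγ1, ← expMap_smul hc x v t] at h
    exact h
  -- `ℓ < 2R`
  have hℓR : ℓ < 2 * R := by
    have hxy : g.edist hg x y ≤ g.edist hg x p + g.edist hg p y := g.edist_triangle hg x p y
    rw [← hmin, g.edist_comm hg x p] at hxy
    have hlt : ENNReal.ofReal ℓ < ENNReal.ofReal R + ENNReal.ofReal R :=
      hxy.trans_lt (ENNReal.add_lt_add hx hy)
    rw [← ENNReal.ofReal_add hR.le hR.le] at hlt
    have := (ENNReal.ofReal_lt_ofReal_iff (by linarith)).1 hlt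
    linarith
  -- the two triangle inequalities through `x` and through `y`
  rcases le_or_gt t (1 / 2) with hth | hth
  · calc g.edist hg p (expMap g.leviCivita x (t • v))
        ≤ g.edist hg p x + g.edist hg x (expMap g.leviCivita x (t • v)) := g.edist_triangle hg _ _ _
      _ < ENNReal.ofReal R + ENNReal.ofReal (t * ℓ) :=
          ENNReal.add_lt_add_of_lt_of_le (ne_top_of_le_ne_top ENNReal.ofReal_ne_top h1) hx h1
      _ = ENNReal.ofReal (R + t * ℓ) := (ENNReal.ofReal_add hR.le (mul_nonneg ht.1 hℓ0)).symm
      _ ≤ ENNReal.ofReal (2 * R) := ENNReal.ofReal_le_ofReal (by nlinarith)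
  · calc g.edist hg p (expMap g.leviCivita x (t • v))
        ≤ g.edist hg p y + g.edist hg y (expMap g.leviCivita x (t • v)) := g.edist_triangle hg _ _ _
      _ < ENNReal.ofReal R + ENNReal.ofReal ((1 - t) * ℓ) := by
          rw [g.edist_comm hg y]
          exact ENNReal.add_lt_add_of_lt_of_le (ne_top_of_le_ne_top ENNReal.ofReal_ne_top h2) hy h2
      _ = ENNReal.ofReal (R + (1 - t) * ℓ) :=
          (ENNReal.ofReal_add hR.le (mul_nonneg (by linarith [ht.2]) hℓ0)).symm
      _ ≤ ENNReal.ofReal (2 * R) := ENNReal.ofReal_le_ofReal (by nlinarith [ht.2])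

/-- **The (1,1)-Poincaré inequality on balls from the segment inequality** (Cheeger–Colding 1996,
Remark 2.82: "Theorem 2.11 leads directly to a lower bound on the smallest nonzero eigenvalue of
the Laplacian and to Poincaré type inequalities"; P. Buser, Ann. Sci. ÉNS 15 (1982), Lemma 5.1,
for the original). On a connected second countable Riemannian `d`-manifold (`d ≥ 1`) with
complete Levi-Civita connection and `Ric ≥ -(d-1) g`, let `u` be `C¹` with a lower
semicontinuous upper gradient `F` (`|du_x(w)| ≤ F(x)|w|_g`; e.g. `F = |∇u|_g` for smooth `u`),
`B = B_R(p)` an open ball, `R > 0`. Then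
  `∫_{B × B} |u(x) − u(y)| d(Vol × Vol) ≤ 2R (2cosh R)^{d-1} · 2 Vol(B) · ∫_{B_{2R}(p)} F`
(`|u(x) − u(y)| ≤ ℱ_F(x, y)`, minimal geodesics between points of `B` lie in `B_{2R}(p)`,
`D = 2R`, and `setLIntegral_prod_segmentIntegral_le`). Dividing by `Vol(B)` gives the mean
oscillation form `⨍_B |u − u_B| ≤ C(d, R) R ⨍... ∫_{B_{2R}} F`. [cite: CheegerColding1996, §2, Remark 2.82]
[cite: Buser1982, Lemma 5.1] -/
theorem setLIntegral_prod_abs_sub_le (hd : 0 < d) [ConnectedSpace M] [T3Space M]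
    [SecondCountableTopology M] [MeasurableSpace M] [BorelSpace M] (hg : g.IsRiemannian)
    (hc : IsGeodesicallyComplete g.leviCivita)
    (hRic : ∀ (x : M) (w : TangentSpace 𝓘(ℝ, (EuclideanSpace ℝ (Fin d))) x),
      -((d : ℝ) - 1) * g.val x w w ≤ g.leviCivita.ricci x w w)
    {u : M → ℝ} (hu : ContMDiff 𝓘(ℝ, (EuclideanSpace ℝ (Fin d))) 𝓘(ℝ, ℝ) 1 u) {F : M → ℝ≥0∞}
    (hFl : LowerSemicontinuous F)
    (hF : ∀ (x : M) (w : TangentSpace 𝓘(ℝ, (EuclideanSpace ℝ (Fin d))) x),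
      ENNReal.ofReal |mvfderiv 𝓘(ℝ, (EuclideanSpace ℝ (Fin d))) u x w| ≤
        F x * ENNReal.ofReal (Real.sqrt (g.val x w w)))
    (p : M) {R : ℝ} (hR : 0 < R) :
    ∫⁻ z in {x : M | g.edist hg p x < ENNReal.ofReal R} ×ˢ {x : M | g.edist hg p x < ENNReal.ofReal R},
        ENNReal.ofReal |u z.1 - u z.2|
        ∂((riemannianMeasure (I := 𝓘(ℝ, (EuclideanSpace ℝ (Fin d))))
            (g.toContMDiffRiemannianMetric hg)).prod
          (riemannianMeasure (I := 𝓘(ℝ, (EuclideanSpace ℝ (Fin d))))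
            (g.toContMDiffRiemannianMetric hg))) ≤
      ENNReal.ofReal ((2 * Real.cosh R) ^ (d - 1)) * ENNReal.ofReal (2 * R) *
        (2 * (riemannianMeasure (I := 𝓘(ℝ, (EuclideanSpace ℝ (Fin d))))
            (g.toContMDiffRiemannianMetric hg)) {x : M | g.edist hg p x < ENNReal.ofReal R}) *
        ∫⁻ y in {x : M | g.edist hg p x < ENNReal.ofReal (2 * R)}, F y
          ∂(riemannianMeasure (I := 𝓘(ℝ, (EuclideanSpace ℝ (Fin d))))
            (g.toContMDiffRiemannianMetric hg)) := by
  set B : Set M := {x : M | g.edist hg p x < ENNReal.ofReal R} with hB_def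
  set U : Set M := {x : M | g.edist hg p x < ENNReal.ofReal (2 * R)} with hU_def
  have hopen : ∀ r : ℝ, IsOpen {x : M | g.edist hg p x < ENNReal.ofReal r} := fun r ↦
    isOpen_lt ((continuous_edist hg).comp (continuous_const.prodMk continuous_id)) continuous_const
  have hBm : MeasurableSet B := (hopen R).measurableSet
  have hUm : MeasurableSet U := (hopen (2 * R)).measurableSet
  -- the hypotheses of the segment inequality with `D = 2R`
  have hBD : ∀ x ∈ B, ∀ y ∈ B, g.edist hg x y ≤ ENNReal.ofReal (2 * R) := by
    intro x hx y hy
    have hx' : g.edist hg p x < ENNReal.ofReal R := hx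
    have hy' : g.edist hg p y < ENNReal.ofReal R := hy
    calc g.edist hg x y ≤ g.edist hg x p + g.edist hg p y := g.edist_triangle hg x p y
      _ ≤ ENNReal.ofReal R + ENNReal.ofReal R := by
          rw [g.edist_comm hg x p]; exact add_le_add hx'.le hy'.le
      _ = ENNReal.ofReal (2 * R) := by rw [← ENNReal.ofReal_add hR.le hR.le, two_mul]
  have hBU : ∀ x ∈ B, ∀ y ∈ B, ∀ v : TangentSpace 𝓘(ℝ, (EuclideanSpace ℝ (Fin d))) x,
      IsMinimizingUpTo g hg x v 1 → expMap g.leviCivita x v = y →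
        ∀ t ∈ Icc (0 : ℝ) 1, expMap g.leviCivita x (t • v) ∈ U :=
    fun x hx y hy v hv hvy t ht ↦ edist_expMap_smul_lt_of_isMinimizingUpTo g hg hc hx hy hv hvy ht
  -- `|u(x) - u(y)| ≤ ℱ_F(x, y)`
  have hptw : ∀ x y : M, ENNReal.ofReal |u x - u y| ≤ segmentIntegral g hg F 0 1 x y := by
    intro x y
    refine le_segmentIntegral hg fun v hv hvy ↦ ?_
    rw [abs_sub_comm, ← hvy]
    exact ofReal_abs_sub_le_mul_lintegral_of_mvfderiv_le g hc hu hF x v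
  have hcosh : Real.cosh (2 * R / 2) = Real.cosh R := by rw [mul_div_cancel_left₀ R two_ne_zero]
  calc ∫⁻ z in B ×ˢ B, ENNReal.ofReal |u z.1 - u z.2| ∂_
      ≤ ∫⁻ z in B ×ˢ B, segmentIntegral g hg F 0 1 z.1 z.2 ∂_ := lintegral_mono fun z ↦ hptw z.1 z.2
    _ ≤ ENNReal.ofReal ((2 * Real.cosh (2 * R / 2)) ^ (d - 1)) * ENNReal.ofReal (2 * R) *
          ((riemannianMeasure (I := 𝓘(ℝ, (EuclideanSpace ℝ (Fin d))))
              (g.toContMDiffRiemannianMetric hg)) B +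
            (riemannianMeasure (I := 𝓘(ℝ, (EuclideanSpace ℝ (Fin d))))
              (g.toContMDiffRiemannianMetric hg)) B) *
          ∫⁻ y in U, F y ∂(riemannianMeasure (I := 𝓘(ℝ, (EuclideanSpace ℝ (Fin d))))
            (g.toContMDiffRiemannianMetric hg)) :=
        setLIntegral_prod_segmentIntegral_le g hd hg hc hRic hBm hBm hUm (by linarith) hBD hBU hFl
    _ = _ := by rw [hcosh, two_mul (riemannianMeasure _ B)]

end Poincare

section Smooth

variable {d : ℕ} {M : Type*} [TopologicalSpace M] [ChartedSpace (EuclideanSpace ℝ (Fin d)) M]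
  [IsManifold 𝓘(ℝ, EuclideanSpace ℝ (Fin d)) ∞ M] [T2Space M]
  (g : PseudoRiemannianMetric 𝓘(ℝ, EuclideanSpace ℝ (Fin d)) ∞ (EuclideanSpace ℝ (Fin d))
    (TangentSpace 𝓘(ℝ, EuclideanSpace ℝ (Fin d)) : M → Type _)) [g.HasLeviCivita]
  [CovariantDerivative.ContMDiffCovariantDerivative g.leviCivita 1]
  [CovariantDerivative.ContMDiffCovariantDerivative g.leviCivita ∞]

/-- **The (1,1)-Poincaré inequality on balls for smooth functions**, with the upper gradient
`|∇u|_g = √(g⁻¹(du, du))` (`gradSq`; Cauchy–Schwarz `abs_mvfderiv_le_sqrt_gradSq_mul_sqrt`):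
under `Ric ≥ -(d-1) g`,
`∫_{B_R(p) × B_R(p)} |u(x) − u(y)| ≤ 2R (2cosh R)^{d-1} · 2 Vol(B_R(p)) · ∫_{B_{2R}(p)} |∇u|_g`.
[cite: CheegerColding1996, §2, Remark 2.82] [cite: Buser1982, Lemma 5.1] -/
theorem setLIntegral_prod_abs_sub_le_gradient (hd : 0 < d) [ConnectedSpace M] [T3Space M]
    [SecondCountableTopology M] [MeasurableSpace M] [BorelSpace M] (hg : g.IsRiemannian)
    (hc : IsGeodesicallyComplete g.leviCivita)
    (hRic : ∀ (x : M) (w : TangentSpace 𝓘(ℝ, (EuclideanSpace ℝ (Fin d))) x),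
      -((d : ℝ) - 1) * g.val x w w ≤ g.leviCivita.ricci x w w)
    {u : M → ℝ} (hu : ContMDiff 𝓘(ℝ, (EuclideanSpace ℝ (Fin d))) 𝓘(ℝ, ℝ) ∞ u)
    (p : M) {R : ℝ} (hR : 0 < R) :
    ∫⁻ z in {x : M | g.edist hg p x < ENNReal.ofReal R} ×ˢ {x : M | g.edist hg p x < ENNReal.ofReal R},
        ENNReal.ofReal |u z.1 - u z.2|
        ∂((riemannianMeasure (I := 𝓘(ℝ, (EuclideanSpace ℝ (Fin d))))
            (g.toContMDiffRiemannianMetric hg)).prod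
          (riemannianMeasure (I := 𝓘(ℝ, (EuclideanSpace ℝ (Fin d))))
            (g.toContMDiffRiemannianMetric hg))) ≤
      ENNReal.ofReal ((2 * Real.cosh R) ^ (d - 1)) * ENNReal.ofReal (2 * R) *
        (2 * (riemannianMeasure (I := 𝓘(ℝ, (EuclideanSpace ℝ (Fin d))))
            (g.toContMDiffRiemannianMetric hg)) {x : M | g.edist hg p x < ENNReal.ofReal R}) *
        ∫⁻ y in {x : M | g.edist hg p x < ENNReal.ofReal (2 * R)},
          ENNReal.ofReal (Real.sqrt (g.gradSq u y))
          ∂(riemannianMeasure (I := 𝓘(ℝ, (EuclideanSpace ℝ (Fin d))))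
            (g.toContMDiffRiemannianMetric hg)) := by
  refine setLIntegral_prod_abs_sub_le g hd hg hc hRic (hu.of_le (by exact_mod_cast le_top)) ?_
    (fun x w ↦ ?_) p hR
  · exact (ENNReal.continuous_ofReal.comp (Real.continuous_sqrt.comp
      (contMDiff_gradSq g hu).continuous)).lowerSemicontinuous
  · rw [← ENNReal.ofReal_mul (Real.sqrt_nonneg _)]
    exact ENNReal.ofReal_le_ofReal (abs_mvfderiv_le_sqrt_gradSq_mul_sqrt g hg u x w)

end Smooth

end Literature.Geometry.Riemannian
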